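import Literature.MathematicalPhysics.KineticTheory.HardSphereWindowPressureStatic
import Literature.MathematicalPhysics.KineticTheory.HardSphereDisplacementPathLength
import Literature.Analysis.FluidPDE.HardSpherePhaseSpaceProofs

/-!
# Within-lag shot-noise pressure, prelim: pathwise and elementary lemmas

Route `AntiMazurCoboundaries` of `AtomisticToContinuum/HydrodynamicLimit`, crux stmt-AtomisticToContinuum-14135
(`CorrectorPressureDecay`), line `almost-invariant-duality`, lead-held layer-2 input h₂ = WITHIN-LAG SHOT-NOISE PRESSURE
(hypothesis `h₂` of `TransferSkeleton.correctorPressureDecay_of_inputs`). This prelim file (`--supports`, registered sub-goal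
`wander_le_windowAvg`) carries the flow-generic ingredients of the assembly
(`Theorems/AntiMazurCoboundariesCorrectorPressureDecayShotNoisePressure.lean`):

* `sum_sub_sum_flow_le` — PER-TIME BOUND along a good orbit: for a one-body `f` with `|f| ≤ K₁` and continuity budget `K₁η`
  at scale `ρ`, and a tameness radius `r < ρ`, `Σᵢ f(zᵢ) − Σᵢ f((Φ_u z)ᵢ) ≤ n·K₁η + 2K₁·#{i | vᵢ(u) ≠ vᵢ(0) ∨ r < dᵢ}`
  (`dᵢ = ∫₀ᴸ‖vᵢ‖` the path length; displacement ≤ path length, `HardSphereFlow.euclidDist_flow_le_integral_norm_vel`);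
* `wander_le_windowAvg` — the WANDERER TERM `4AK₁·[RL < d_j]·(2 + 1331(d_j/ε + 1))` is dominated by the time average
  `L⁻¹∫₀ᴸ (4AK₁·2664/R)·max 0 (2‖v_j(t)‖ − R) dt` (elementary Jensen `max 0 (∫g) ≤ ∫ max 0 g`);
* `exp_amgm`, `mul_sub_avg_le`, `lintegral_le_of_ae_le_mul_add`, `ell_pos`, `ell_le_one`, `ell_lt_of_lt` — elementary real / measure / scale facts used by the assembly.
-/

noncomputable section

open MeasureTheory Set Filter Topology
open scoped ENNReal Classical

namespace Summit.AtomisticToContinuum.HydrodynamicLimit.Theorems.ShotNoisePressure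

open Literature.Analysis.FluidPDE
open Literature.MathematicalPhysics.KineticTheory (T3 V3)

/-! ## Small helpers -/

/-- `ℓ_N = (N+1)^{-1/3}` is positive. [folklore] -/
theorem ell_pos (N : ℕ) : 0 < ((N + 1 : ℕ) : ℝ) ^ (-(1 / 3 : ℝ)) :=
  Real.rpow_pos_of_pos (Nat.cast_pos.mpr (Nat.succ_pos N)) _

/-- `ℓ_N ≤ 1`. [folklore] -/
theorem ell_le_one (N : ℕ) : ((N + 1 : ℕ) : ℝ) ^ (-(1 / 3 : ℝ)) ≤ 1 :=
  Real.rpow_le_one_of_one_le_of_nonpos (by exact_mod_cast Nat.succ_le_succ (Nat.zero_le N))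
    (by norm_num)

/-- `ℓ_N < ρ` once `N + 1 > ρ⁻³`. [folklore] -/
theorem ell_lt_of_lt {ρ : ℝ} (hρ : 0 < ρ) {N : ℕ} (hN : ρ⁻¹ ^ (3 : ℕ) < ((N + 1 : ℕ) : ℝ)) :
    ((N + 1 : ℕ) : ℝ) ^ (-(1 / 3 : ℝ)) < ρ := by
  have hn : (0 : ℝ) < ((N + 1 : ℕ) : ℝ) := Nat.cast_pos.mpr (Nat.succ_pos N)
  have h1 : ((N + 1 : ℕ) : ℝ) ^ (-(1 / 3 : ℝ)) = ((((N + 1 : ℕ) : ℝ)) ^ ((1 / 3 : ℝ)))⁻¹ := by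
    rw [Real.rpow_neg hn.le]
  rw [h1]
  have h2 : ρ⁻¹ < ((N + 1 : ℕ) : ℝ) ^ ((1 / 3 : ℝ)) := by
    have h3 : (ρ⁻¹ ^ (3 : ℕ)) ^ ((1 / 3 : ℝ)) < ((N + 1 : ℕ) : ℝ) ^ ((1 / 3 : ℝ)) :=
      Real.rpow_lt_rpow (by positivity) hN (by norm_num)
    have h4 : (ρ⁻¹ ^ (3 : ℕ)) ^ ((1 / 3 : ℝ)) = ρ⁻¹ := by
      rw [← Real.rpow_natCast, ← Real.rpow_mul (inv_nonneg.2 hρ.le)]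
      norm_num
    rwa [h4] at h3
  rw [inv_lt_comm₀ (Real.rpow_pos_of_pos hn _) hρ]
  exact h2

/-! ## The two pathwise estimates -/

/-- **Per-time bound.** For a good orbit, `u ∈ [0, L]`, a one-body `f` with `|f| ≤ K₁` and continuity budget
`f(x, v) − f(y, v) ≤ K₁η` whenever `dist x y < ρ`, and a tameness radius `r < ρ`:
`Σᵢ f(zᵢ) − Σᵢ f((Φ_u z)ᵢ) ≤ n·K₁η + 2K₁·#{i | vᵢ(u) ≠ vᵢ(0) ∨ r < dᵢ}` (`dᵢ` the path length on `[0, L]`):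
a sphere outside the set kept its velocity and moved by `≤ dᵢ ≤ r < ρ`. [folklore] -/
theorem sum_sub_sum_flow_le {n : ℕ} {ε : ℝ} (Φ : HardSphereFlow (Torus.geometry (Fin 3)) ε n)
    {z : Config n (Fin 3) T3} (hz : z ∈ Φ.good) {L r ρ K₁ η : ℝ} (hrρ : r < ρ) (hK₁ : 0 ≤ K₁)
    (hη : 0 ≤ η) (f : T3 × V3 → ℝ) (hfK : ∀ q, |f q| ≤ K₁)
    (hfcont : ∀ (x y : T3) (v : V3), dist x y < ρ → f (x, v) - f (y, v) ≤ K₁ * η)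
    {u : ℝ} (hu : u ∈ Icc 0 L) :
    ∑ i, f (z i) - ∑ i, f (Φ.flow u z i) ≤ n * (K₁ * η) + 2 * K₁ *
      ((Finset.univ.filter fun i : Fin n =>
        (Φ.flow u z i).2 ≠ (z i).2 ∨ r < ∫ t in (0 : ℝ)..L, ‖(Φ.flow t z i).2‖).card : ℝ) := by
  set B := Finset.univ.filter fun i : Fin n =>
    (Φ.flow u z i).2 ≠ (z i).2 ∨ r < ∫ t in (0 : ℝ)..L, ‖(Φ.flow t z i).2‖ with hB
  have hterm : ∀ i, f (z i) - f (Φ.flow u z i) ≤ K₁ * η + (if i ∈ B then 2 * K₁ else 0) := by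
    intro i
    by_cases hi : i ∈ B
    · rw [if_pos hi]
      have h1 := (abs_le.1 (hfK (z i))).2
      have h2 := (abs_le.1 (hfK (Φ.flow u z i))).1
      nlinarith [mul_nonneg hK₁ hη]
    · rw [if_neg hi, add_zero]
      have hi' : (Φ.flow u z i).2 = (z i).2 ∧ (∫ t in (0 : ℝ)..L, ‖(Φ.flow t z i).2‖) ≤ r := by
        have : ¬ ((Φ.flow u z i).2 ≠ (z i).2 ∨ r < ∫ t in (0 : ℝ)..L, ‖(Φ.flow t z i).2‖) := by
          simpa [hB] using hi
        push Not at this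
        exact this
      -- displacement ≤ path length on `[0, u]` ≤ path length on `[0, L]`
      have hdisp : Torus.euclidDist (Φ.flow u z i).1 (z i).1 ≤ r := by
        have h1 := Φ.euclidDist_flow_le_integral_norm_vel hz i hu.1
        rw [Φ.flow_zero z hz] at h1
        have h2 : (∫ t in (0 : ℝ)..u, ‖(Φ.flow t z i).2‖) ≤ ∫ t in (0 : ℝ)..L, ‖(Φ.flow t z i).2‖ :=
          intervalIntegral.integral_mono_interval le_rfl hu.1 hu.2
            (Filter.Eventually.of_forall fun _ => norm_nonneg _) (Φ.intervalIntegrable_norm_vel_flow hz i 0 L)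
        linarith [hi'.2]
      have hdist : dist (z i).1 (Φ.flow u z i).1 < ρ := by
        rw [dist_comm]
        rw [dist_eq_norm]
        exact ((Torus.norm_sub_le_euclidDist_holds _ _).trans hdisp).trans_lt hrρ
      have := hfcont (z i).1 (Φ.flow u z i).1 (z i).2 hdist
      have hzi : f (z i) = f ((z i).1, (z i).2) := rfl
      have hfi : f (Φ.flow u z i) = f ((Φ.flow u z i).1, (z i).2) := by
        rw [← hi'.1]
      rw [hzi, hfi]
      exact this
  calc ∑ i, f (z i) - ∑ i, f (Φ.flow u z i) = ∑ i, (f (z i) - f (Φ.flow u z i)) := by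
        rw [Finset.sum_sub_distrib]
    _ ≤ ∑ i : Fin n, (K₁ * η + (if i ∈ B then 2 * K₁ else 0)) := Finset.sum_le_sum fun i _ => hterm i
    _ = n * (K₁ * η) + 2 * K₁ * (B.card : ℝ) := by
        rw [Finset.sum_add_distrib, Finset.sum_const, Finset.card_univ, Fintype.card_fin, nsmul_eq_mul,
          ← Finset.sum_filter, Finset.filter_mem_eq_inter, Finset.univ_inter, Finset.sum_const, nsmul_eq_mul]
        ring

/-- **The wanderer term is dominated by a time average.** With `r = R·L`, `0 < r ≤ ε`, `d_j = ∫₀ᴸ‖v_j‖`: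
`4AK₁·[r < d_j]·(2 + 1331(d_j/ε + 1)) ≤ L⁻¹∫₀ᴸ (4AK₁·2664/R)·max 0 (2‖v_j(t)‖ − R) dt`
(if `r < d_j` the bracket is `≤ 2664(2d_j/r − 1)`, and `2d_j − RL = ∫₀ᴸ(2‖v_j‖ − R) ≤ ∫₀ᴸ max 0 (2‖v_j‖ − R)`). [folklore] -/
theorem wander_le_windowAvg : ∀ {n : ℕ} {ε : ℝ} (Φ : HardSphereFlow (Torus.geometry (Fin 3)) ε n)
    {z : Config n (Fin 3) T3} (_ : z ∈ Φ.good) {L R A K₁ : ℝ} (_ : 0 < L) (_ : 0 < R) (_ : 0 < A)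
    (_ : 0 < K₁) (_ : R * L ≤ ε) (j : Fin n),
    4 * A * K₁ * (if R * L < ∫ t in (0 : ℝ)..L, ‖(Φ.flow t z j).2‖ then
        2 + 1331 * ((∫ t in (0 : ℝ)..L, ‖(Φ.flow t z j).2‖) / ε + 1) else 0) ≤
      L⁻¹ * ∫ t in (0 : ℝ)..L, 4 * A * K₁ * 2664 / R * max 0 (2 * ‖(Φ.flow t z j).2‖ - R) := by
  intro n ε Φ z hz L R A K₁ hL hR hA hK₁ hrε j
  set d : ℝ := ∫ t in (0 : ℝ)..L, ‖(Φ.flow t z j).2‖ with hd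
  have hr : 0 < R * L := mul_pos hR hL
  have hε : 0 < ε := hr.trans_le hrε
  have hcont : Continuous fun w : Config n (Fin 3) T3 => max 0 (2 * ‖(w j).2‖ - R) := by fun_prop
  have hint : IntervalIntegrable (fun t => max 0 (2 * ‖(Φ.flow t z j).2‖ - R)) volume 0 L :=
    Φ.intervalIntegrable_comp_flow_of_continuous hz hcont 0 L
  have hpos : 0 ≤ ∫ t in (0 : ℝ)..L, max 0 (2 * ‖(Φ.flow t z j).2‖ - R) :=
    intervalIntegral.integral_nonneg hL.le fun t _ => le_max_left _ _
  have hrhs : L⁻¹ * ∫ t in (0 : ℝ)..L, 4 * A * K₁ * 2664 / R * max 0 (2 * ‖(Φ.flow t z j).2‖ - R) =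
      4 * A * K₁ * 2664 / (R * L) * ∫ t in (0 : ℝ)..L, max 0 (2 * ‖(Φ.flow t z j).2‖ - R) := by
    rw [intervalIntegral.integral_const_mul]
    field_simp
  rw [hrhs]
  split_ifs with hlt
  · -- `2d − RL ≤ ∫ max 0 (2‖v‖ − R)`
    have hkey : 2 * d - R * L ≤ ∫ t in (0 : ℝ)..L, max 0 (2 * ‖(Φ.flow t z j).2‖ - R) := by
      have h1 : (∫ t in (0 : ℝ)..L, (2 * ‖(Φ.flow t z j).2‖ - R)) = 2 * d - R * L := by
        rw [intervalIntegral.integral_sub ((Φ.intervalIntegrable_norm_vel_flow hz j 0 L).const_mul 2)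
          intervalIntegrable_const, intervalIntegral.integral_const_mul, intervalIntegral.integral_const,
          sub_zero, smul_eq_mul, hd]
        ring
      rw [← h1]
      exact intervalIntegral.integral_mono_on hL.le
        (((Φ.intervalIntegrable_norm_vel_flow hz j 0 L).const_mul 2).sub intervalIntegrable_const) hint
        fun t _ => le_max_right _ _
    -- arithmetic: `4AK₁(1333 + 1331 d/ε) ≤ (4AK₁·2664/(RL))·(2d − RL)`
    have hdε : d / ε ≤ d / (R * L) := by
      have hd0 : 0 ≤ d := intervalIntegral.integral_nonneg hL.le fun t _ => norm_nonneg _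
      exact div_le_div_of_nonneg_left hd0 hr hrε
    have hAK : 0 < 4 * A * K₁ := by positivity
    have hq : 1 ≤ d / (R * L) := by rw [le_div_iff₀ hr]; linarith
    calc 4 * A * K₁ * (2 + 1331 * (d / ε + 1))
        ≤ 4 * A * K₁ * (2664 * (2 * (d / (R * L)) - 1)) := by
          apply mul_le_mul_of_nonneg_left _ hAK.le
          nlinarith
      _ = 4 * A * K₁ * 2664 / (R * L) * (2 * d - R * L) := by field_simp
      _ ≤ 4 * A * K₁ * 2664 / (R * L) * ∫ t in (0 : ℝ)..L, max 0 (2 * ‖(Φ.flow t z j).2‖ - R) :=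
          mul_le_mul_of_nonneg_left hkey (by positivity)
  · simpa using mul_nonneg (by positivity : (0 : ℝ) ≤ 4 * A * K₁ * 2664 / (R * L)) hpos

/-! ## Three elementary lemmas -/

/-- `exp(a + x + y/2) ≤ (e^a/2)(e^{2x} + e^y)` (from `2XY ≤ X² + Y²`). [folklore] -/
theorem exp_amgm (a x y : ℝ) :
    Real.exp (a + x + 2⁻¹ * y) ≤ Real.exp a / 2 * (Real.exp (2 * x) + Real.exp y) := by
  rw [Real.exp_add, Real.exp_add]
  have h2 : Real.exp (2 * x) = Real.exp x ^ 2 := by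
    rw [← Real.exp_nat_mul]; norm_num
  have h3 : Real.exp y = Real.exp (2⁻¹ * y) ^ 2 := by
    rw [← Real.exp_nat_mul]; congr 1; ring
  rw [h2, h3]
  have hE := Real.exp_pos a
  have key : Real.exp x * Real.exp (2⁻¹ * y) ≤ (Real.exp x ^ 2 + Real.exp (2⁻¹ * y) ^ 2) / 2 := by
    nlinarith [two_mul_le_add_sq (Real.exp x) (Real.exp (2⁻¹ * y))]
  calc Real.exp a * Real.exp x * Real.exp (2⁻¹ * y) = Real.exp a * (Real.exp x * Real.exp (2⁻¹ * y)) := by ring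
    _ ≤ Real.exp a * ((Real.exp x ^ 2 + Real.exp (2⁻¹ * y) ^ 2) / 2) := mul_le_mul_of_nonneg_left key hE.le
    _ = Real.exp a / 2 * (Real.exp x ^ 2 + Real.exp (2⁻¹ * y) ^ 2) := by ring

/-- Averaging a `u`-uniform bound: if `A(c − G u) ≤ M` on `[0, L]` then `A(c − L⁻¹∫₀ᴸ G) ≤ M`. [folklore] -/
theorem mul_sub_avg_le {G : ℝ → ℝ} {L A c M : ℝ} (hL : 0 < L) (hG : IntervalIntegrable G volume 0 L)
    (h : ∀ u ∈ Icc 0 L, A * (c - G u) ≤ M) : A * (c - L⁻¹ * ∫ u in (0 : ℝ)..L, G u) ≤ M := by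
  have hrew : A * (c - L⁻¹ * ∫ u in (0 : ℝ)..L, G u) = L⁻¹ * ∫ u in (0 : ℝ)..L, A * (c - G u) := by
    rw [intervalIntegral.integral_const_mul, intervalIntegral.integral_sub intervalIntegrable_const hG,
      intervalIntegral.integral_const, sub_zero, smul_eq_mul]
    field_simp
  rw [hrew]
  have hmono : (∫ u in (0 : ℝ)..L, A * (c - G u)) ≤ ∫ _u in (0 : ℝ)..L, M :=
    intervalIntegral.integral_mono_on hL.le ((intervalIntegrable_const.sub hG).const_mul A)
      intervalIntegrable_const fun u hu => h u hu
  rw [intervalIntegral.integral_const, sub_zero, smul_eq_mul] at hmono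
  calc L⁻¹ * ∫ u in (0 : ℝ)..L, A * (c - G u) ≤ L⁻¹ * (L * M) := mul_le_mul_of_nonneg_left hmono (inv_nonneg.2 hL.le)
    _ = M := by field_simp

/-- Integrating an a.e. bound `P ≤ C(X + Y)` against bounds `∫X ≤ B`, `∫Y ≤ B`. [folklore] -/
theorem lintegral_le_of_ae_le_mul_add {Ω : Type*} [MeasurableSpace Ω] {μ : Measure Ω} {P X Y : Ω → ℝ≥0∞}
    {C B : ℝ≥0∞} (hC : C ≠ ∞) (h : ∀ᵐ z ∂μ, P z ≤ C * (X z + Y z)) (hX : ∫⁻ z, X z ∂μ ≤ B)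
    (hY : ∫⁻ z, Y z ∂μ ≤ B) (hYm : AEMeasurable Y μ) : ∫⁻ z, P z ∂μ ≤ C * (B + B) := by
  calc ∫⁻ z, P z ∂μ ≤ ∫⁻ z, C * (X z + Y z) ∂μ := lintegral_mono_ae h
    _ = C * ((∫⁻ z, X z ∂μ) + ∫⁻ z, Y z ∂μ) := by
        rw [lintegral_const_mul' _ _ hC, lintegral_add_right' _ hYm]
    _ ≤ C * (B + B) := by gcongr

end Summit.AtomisticToContinuum.HydrodynamicLimit.Theorems.ShotNoisePressure

end
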